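import Mathlib
import Literature.Combinatorics.Optimization.RandomThreeCnfValueCount
import Literature.Combinatorics.Optimization.GrigorievSchoenebeckPseudoDensity

/-!
# A Boolean pseudoexpectation refutes every sum-of-squares certificate on the cube
# (the bridge `SOSFailsToRefute` ⇒ `¬ HasSosCertificate`)

General bridge between the tree's two sum-of-squares vocabularies (companion of
`GrigorievSchoenebeckPseudoDensity.lean`, which transports the SPECIFIC Grigoriev–Schoenebeck
moments; here the pseudoexpectation is ARBITRARY):

* MetaComplexity (Kothari–Mori–O'Donnell–Witmer 2017, Defs. 2.7–2.8; `SumOfSquares.lean`): a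
  degree-`d` pseudoexpectation is a linear functional `E` on `ℝ[x_v : v ∈ ℕ]` with `E 1 = 1`,
  `E(p²) ≥ 0` for `2 deg p ≤ d`, SATISFYING the Booleanity identities `x_v² − x_v = 0` and the clause
  identities `unsatPoly C = 0` in degree `d` (`SOSFailsToRefute d φ`);
* Optimization (Lee–Raghavendra–Steurer 2015; `PatternMatrixPsdRank.lean`): a degree-`d'`
  sum-of-squares CERTIFICATE of `f : {0,1}ⁿ → ℝ` is `f = Σ g_j²` ON THE CUBE with the `g_j` of degree
  `≤ d'/2` (`HasSosCertificate`), degrees being those of representing real polynomials.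

**Theorem (`eq_zero_of_forall_eval_zeroOne`).** A degree-`d` pseudoexpectation satisfying all
Booleanity identities vanishes on every polynomial of degree `≤ d` that vanishes on `{0,1}^ℕ` —
by Alon's Combinatorial Nullstellensatz with the degree bound (Mathlib's
`combinatorial_nullstellensatz_exists_linearCombination` with `S_i = {0,1}`): such a polynomial is
`Σ_i (x_i² − x_i) h_i` with `deg h_i + 2 ≤ d`.

**Theorem (`not_hasSosCertificate_of_pseudoexpectation`).** If the constraints of a Boolean
Max-CSP instance `ℑ` on `n` variables are clauses `C_i` (`(ℑ.cons i).sat x ↔ C_i` true at `x`,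
variables `< n`, `|C_i| ≤ d`) and a degree-`d` pseudoexpectation satisfies Booleanity and all the
identities `unsatPoly C_i = 0`, then for every `c < 1` and `d' ≤ d` the function `c − ℑ` has NO
degree-`d'` certificate on the cube: a certificate `c − ℑ = Σ g_j²` lifts to a polynomial identity
modulo a polynomial vanishing on `{0,1}^ℕ` of degree `≤ d`, and applying `E` gives
`0 = c − 1 − Σ E(P_j²) < 0`.  Corollary `not_hasSosCertificate_of_sosFailsToRefute` for clause
tuples `ω : Fin m → kClauses 3 n` and the instance `satInstance ω` of
`RandomThreeCnfValueCount.lean`: `SOSFailsToRefute d (List.ofFn ω) → ¬ HasSosCertificate d' (c − ℑ_ω)`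
(`3 ≤ d`, `d' ≤ d`, `c < 1`) — so EVERY MetaComplexity-side SOS lower bound for 3-CNFs (e.g. the
tree's KMOW theorem `kmow_sos_random_kSAT_holds`) is consumable by the Lee–Raghavendra–Steurer
layer (`LeeRaghavendraSteurer2015_thm16_holds`, `_thm64_repaired_holds`).

This is the weak-duality direction of "degree-`d` SOS fails to refute iff a degree-`d`
pseudoexpectation exists" (KMOW §2.3; Fleming–Kothari–Pitassi 2019, Thm 3.50 / §3.2.2 duality)
specialised to the hypercube, where the quotient by the Booleanity ideal is exact in bounded degree
thanks to the Nullstellensatz degree bound.  Everything is proved; no named facts.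

## References

* P. K. Kothari, R. Mori, R. O'Donnell, D. Witmer, *Sum of squares lower bounds for refuting any
  CSP*, STOC 2017 (arXiv:1701.04521), Defs. 2.7–2.8, §2.3 [arXiv170104521].
* N. Fleming, P. Kothari, T. Pitassi, *Semialgebraic Proofs and Efficient Algorithm Design* (2019),
  §3.2 (pseudo-expectations vs SoS refutations over the Boolean cube) [FlemingKothariPitassi2019].
* N. Alon, *Combinatorial Nullstellensatz*, Combin. Probab. Comput. 8 (1999), Thm 1.1 (Mathlib).
* J. R. Lee, P. Raghavendra, D. Steurer, STOC 2015, §1 (sos degree, certificates)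
  [LeeRaghavendraSteurer2015].
-/

noncomputable section

open Finset MvPolynomial
open Literature.Computability.Complexity (Literal Clause kClauses)
open Literature.Computability.MetaComplexity (IsPseudoexpectation SatisfiesIdentity boolAxiom
  unsatPoly litFalsePoly SOSFailsToRefute totalDegree_unsatPoly nodup_map_fst_of_mem_kClauses)

namespace Literature.Combinatorics.Optimization

/-! ### Booleanity kills cube-vanishing polynomials of low degree -/

/-- The Booleanity axiom in `n` variables as the Nullstellensatz product `∏_{s ∈ {0,1}} (x_i − s)`.
[cite: arXiv170104521, §2.3 ("`x_i² = x_i`")] -/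
theorem prod_X_sub_C_zeroOne {n : ℕ} (i : Fin n) :
    ∏ s ∈ ({0, 1} : Finset ℝ), (X i - C s : MvPolynomial (Fin n) ℝ) = X i ^ 2 - X i := by
  rw [Finset.prod_pair (by norm_num : (0 : ℝ) ≠ 1)]
  simp only [map_zero, sub_zero, map_one]
  ring

/-- `x_i² − x_i` has total degree at least `2` (the monomial `x_i²` occurs). [cite: arXiv170104521, §2.3] -/
theorem two_le_totalDegree_X_sq_sub_X {n : ℕ} (i : Fin n) :
    2 ≤ (X i ^ 2 - X i : MvPolynomial (Fin n) ℝ).totalDegree := by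
  classical
  have hs : (Finsupp.single i 2) ∈ (X i ^ 2 - X i : MvPolynomial (Fin n) ℝ).support := by
    rw [mem_support_iff, coeff_sub, coeff_X_pow, coeff_X, if_pos rfl, if_neg]
    · norm_num
    · intro h
      have := congrArg (fun f => f i) h
      simp at this
  have := le_totalDegree hs
  simpa using this

/-- Renaming `x_i² − x_i` to the variables `ℕ` gives the tree's `boolAxiom`. [cite: arXiv170104521, §2.3] -/
theorem rename_X_sq_sub_X {n : ℕ} (i : Fin n) :
    rename Fin.val (X i ^ 2 - X i : MvPolynomial (Fin n) ℝ) = boolAxiom (i : ℕ) := by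
  simp [boolAxiom, rename_X]

/-- `deg (x_v² − x_v) ≤ 2`. [cite: arXiv170104521, §2.3] -/
theorem totalDegree_boolAxiom_le (v : ℕ) : (boolAxiom v).totalDegree ≤ 2 := by
  unfold boolAxiom
  refine (totalDegree_sub _ _).trans (max_le ?_ ?_)
  · rw [totalDegree_X_pow]
  · rw [totalDegree_X]; omega

/-- **A Boolean pseudoexpectation vanishes on cube-vanishing polynomials of degree `≤ d`.** If
`E` (a functional on `ℝ[x_v : v ∈ ℕ]`) satisfies every Booleanity identity `x_v² − x_v = 0` in
degree `d`, and `Q ∈ ℝ[x_i : i < n]` of total degree `≤ d` vanishes at every `0/1` point, then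
`E Q = 0` (reading `Q` in the variables `ℕ`): by the Combinatorial Nullstellensatz,
`Q = Σ_i (x_i² − x_i) h_i` with `deg h_i + 2 ≤ deg Q`.
[cite: arXiv170104521, Def. 2.8 and §2.3 (pseudoexpectations "satisfying `x_i² = x_i`")] -/
theorem eq_zero_of_forall_eval_zeroOne {n d : ℕ} {E : MvPolynomial ℕ ℝ →ₗ[ℝ] ℝ}
    (hB : ∀ v : ℕ, SatisfiesIdentity d E (boolAxiom v)) (Q : MvPolynomial (Fin n) ℝ)
    (hQ : ∀ x : Fin n → ℝ, (∀ i, x i = 0 ∨ x i = 1) → eval x Q = 0) (hdeg : Q.totalDegree ≤ d) :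
    E (rename Fin.val Q) = 0 := by
  classical
  obtain ⟨h, hhdeg, hQeq⟩ := combinatorial_nullstellensatz_exists_linearCombination
    (fun _ : Fin n => ({0, 1} : Finset ℝ)) (fun _ => ⟨0, by simp⟩) Q
    (fun x hx => hQ x fun i => by simpa using hx i)
  simp only [prod_X_sub_C_zeroOne] at hhdeg hQeq
  rw [hQeq, Finsupp.linearCombination_apply, Finsupp.sum, map_sum, map_sum]
  refine Finset.sum_eq_zero fun i _ => ?_
  rw [smul_eq_mul, map_mul, mul_comm, rename_X_sq_sub_X]
  by_cases hz : h i = 0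
  · rw [hz, map_zero, mul_zero, map_zero]
  refine hB i (rename Fin.val (h i)) ?_
  have hne : (X i ^ 2 - X i : MvPolynomial (Fin n) ℝ) ≠ 0 := by
    intro h0
    have := two_le_totalDegree_X_sq_sub_X i
    rw [h0, totalDegree_zero] at this
    omega
  have h1 := hhdeg i
  rw [totalDegree_mul_of_isDomain hne hz] at h1
  have h2 := two_le_totalDegree_X_sq_sub_X i
  have h3 := totalDegree_rename_le Fin.val (h i)
  have h4 := totalDegree_boolAxiom_le (i : ℕ)
  omega

/-! ### Clause polynomials in the variables `Fin n` -/

/-- The falsity polynomial of a literal whose variable is `< n`, in the variables `Fin n`.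
[cite: arXiv170104521, §2.3 (arithmetisation of constraints)] -/
def litFalsePolyFin {n : ℕ} (l : Literal ℕ) (h : l.1 < n) : MvPolynomial (Fin n) ℝ :=
  if l.2 then 1 - X ⟨l.1, h⟩ else X ⟨l.1, h⟩

/-- Renaming recovers the tree's `litFalsePoly`. [cite: arXiv170104521, §2.3] -/
theorem rename_litFalsePolyFin {n : ℕ} (l : Literal ℕ) (h : l.1 < n) :
    rename Fin.val (litFalsePolyFin l h) = litFalsePoly l := by
  unfold litFalsePolyFin litFalsePoly
  split_ifs <;> simp [rename_X]

/-- `deg (litFalsePolyFin l h) ≤ 1`. [cite: arXiv170104521, §2.3] -/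
theorem totalDegree_litFalsePolyFin_le {n : ℕ} (l : Literal ℕ) (h : l.1 < n) :
    (litFalsePolyFin l h).totalDegree ≤ 1 := by
  unfold litFalsePolyFin
  split_ifs
  · refine (totalDegree_sub _ _).trans (max_le ?_ ?_)
    · rw [totalDegree_one]; exact Nat.zero_le _
    · rw [totalDegree_X]
  · rw [totalDegree_X]

/-- The unsatisfaction polynomial of a clause with variables `< n`, in the variables `Fin n`
(product over literal positions). [cite: arXiv170104521, §2.3] -/
def unsatPolyFin {n : ℕ} (C : Clause ℕ) (hC : ∀ l ∈ C, l.1 < n) : MvPolynomial (Fin n) ℝ :=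
  ∏ j : Fin C.length, litFalsePolyFin C[j] (hC _ (List.getElem_mem j.2))

/-- Renaming recovers the tree's `unsatPoly`. [cite: arXiv170104521, §2.3] -/
theorem rename_unsatPolyFin {n : ℕ} (C : Clause ℕ) (hC : ∀ l ∈ C, l.1 < n) :
    rename Fin.val (unsatPolyFin C hC) = unsatPoly C := by
  rw [unsatPolyFin, map_prod, unsatPoly]
  simp_rw [rename_litFalsePolyFin]
  rw [← List.prod_ofFn]
  congr 1
  apply List.ext_getElem
  · simp
  · intro j hj₁ hj₂
    rw [List.getElem_ofFn, List.getElem_map]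
    rfl

/-- `deg (unsatPolyFin C) ≤ |C|`. [cite: arXiv170104521, §2.1] -/
theorem totalDegree_unsatPolyFin_le {n : ℕ} (C : Clause ℕ) (hC : ∀ l ∈ C, l.1 < n) :
    (unsatPolyFin C hC).totalDegree ≤ C.length := by
  unfold unsatPolyFin
  refine (totalDegree_finsetProd _ _).trans ?_
  calc ∑ j : Fin C.length, (litFalsePolyFin C[j] (hC _ (List.getElem_mem j.2))).totalDegree
      ≤ ∑ _j : Fin C.length, 1 := Finset.sum_le_sum fun j _ => totalDegree_litFalsePolyFin_le _ _
    _ = C.length := by simp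

/-! ### Evaluating clause polynomials at `0/1` points -/

/-- The Boolean assignment read off a `0/1` point of `ℝ^ℕ`. [cite: arXiv170104521, §2.3] -/
def boolOf (y : ℕ → ℝ) : ℕ → Bool := fun v => decide (y v = 1)

/-- At a `0/1` point, `litFalsePoly l` evaluates to `1` if the literal is false and `0` otherwise.
[cite: arXiv170104521, §2.3 (arithmetisation of constraints)] -/
theorem eval_litFalsePoly_zeroOne (y : ℕ → ℝ) (hy : ∀ v, y v = 0 ∨ y v = 1) (l : Literal ℕ) :
    eval y (litFalsePoly l) =
      if Literature.Computability.Complexity.Literal.eval (boolOf y) l then 0 else 1 := by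
  rcases l with ⟨v, b⟩
  unfold litFalsePoly
  simp only [Literature.Computability.Complexity.Literal.eval, boolOf]
  rcases hy v with h | h <;> cases b <;> simp [h]

/-- At a `0/1` point, `unsatPoly C` evaluates to the falsity indicator of the clause.
[cite: arXiv170104521, §2.3 ("`C` holds is the identity `unsatPoly C = 0`")] -/
theorem eval_unsatPoly_zeroOne (y : ℕ → ℝ) (hy : ∀ v, y v = 0 ∨ y v = 1) (C : Clause ℕ) :
    eval y (unsatPoly C) =
      if Literature.Computability.Complexity.Clause.eval (boolOf y) C then 0 else 1 := by
  induction C with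
  | nil => simp [unsatPoly, Literature.Computability.Complexity.Clause.eval]
  | cons l C ih =>
    have h1 : unsatPoly (l :: C) = litFalsePoly l * unsatPoly C := by
      rw [unsatPoly, List.map_cons, List.prod_cons]; rfl
    have hcons : Literature.Computability.Complexity.Clause.eval (boolOf y) (l :: C) =
        (Literature.Computability.Complexity.Literal.eval (boolOf y) l ||
          Literature.Computability.Complexity.Clause.eval (boolOf y) C) := by
      simp [Literature.Computability.Complexity.Clause.eval, List.any_cons]
    rw [h1, map_mul, ih, eval_litFalsePoly_zeroOne y hy, hcons]
    cases Literature.Computability.Complexity.Literal.eval (boolOf y) l <;>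
      cases Literature.Computability.Complexity.Clause.eval (boolOf y) C <;> simp

/-- The extension of a point of `ℝ^{Fin n}` to `ℝ^ℕ` by `0`. [cite: arXiv170104521, §2.3] -/
def extReal {n : ℕ} (x : Fin n → ℝ) : ℕ → ℝ := fun v => if h : v < n then x ⟨v, h⟩ else 0

/-- `extReal x ∘ Fin.val = x`. [cite: arXiv170104521, §2.3] -/
theorem extReal_comp_val {n : ℕ} (x : Fin n → ℝ) : extReal x ∘ Fin.val = x := by
  funext i; simp [extReal, i.2]

/-- `extReal` of a `0/1` point is a `0/1` point. [cite: arXiv170104521, §2.3] -/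
theorem extReal_zeroOne {n : ℕ} {x : Fin n → ℝ} (hx : ∀ i, x i = 0 ∨ x i = 1) :
    ∀ v, extReal x v = 0 ∨ extReal x v = 1 := by
  intro v
  unfold extReal
  split_ifs with h
  · exact hx ⟨v, h⟩
  · exact Or.inl rfl

/-- At a `0/1` point, `unsatPolyFin C` evaluates to the falsity indicator of the clause under the
Boolean reading of the extended point. [cite: arXiv170104521, §2.3] -/
theorem eval_unsatPolyFin_zeroOne {n : ℕ} (C : Clause ℕ) (hC : ∀ l ∈ C, l.1 < n)
    (x : Fin n → ℝ) (hx : ∀ i, x i = 0 ∨ x i = 1) :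
    eval x (unsatPolyFin C hC) =
      if Literature.Computability.Complexity.Clause.eval (boolOf (extReal x)) C then 0 else 1 := by
  rw [← eval_unsatPoly_zeroOne (extReal x) (extReal_zeroOne hx) C, ← rename_unsatPolyFin C hC,
    eval_rename, extReal_comp_val]

/-! ### The bridge -/

/-- **A Boolean pseudoexpectation satisfying the clause identities of an instance refutes every
cube certificate below `1`.** Let `ℑ` be a Boolean Max-CSP instance on `n` variables whose
constraints are the clauses `cs i` (satisfaction = clause truth for every assignment extending the
point; variables `< n`; `|cs i| ≤ d`), and `E` a degree-`d` pseudoexpectation satisfying all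
Booleanity identities and all identities `unsatPoly (cs i) = 0`. Then for `c < 1` and `d' ≤ d`,
`c − ℑ` has no degree-`d'` sum-of-squares certificate on `{0,1}ⁿ`: lifting a certificate
`c − ℑ = Σ g_j²` to `Q = c − V − Σ P_j²` (`V = (1/M) Σ_i (1 − unsatPoly (cs i))`), a polynomial of
degree `≤ d` vanishing on the cube, gives `0 = E Q = c − 1 − Σ E(P_j²) < 0`.
[cite: arXiv170104521, §2.3 (degree-`d` SOS fails to refute iff a degree-`d` pseudoexpectation exists — weak duality direction)] -/
theorem not_hasSosCertificate_of_pseudoexpectation {k n : ℕ} {P : Set ((Fin k → Bool) → Bool)}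
    (I : CSPInstance k n P) (cs : Fin I.M → Clause ℕ)
    (hsat : ∀ (i : Fin I.M) (x : Fin n → Bool) (σ : ℕ → Bool), (∀ (v : ℕ) (h : v < n), σ v = x ⟨v, h⟩) →
      (I.cons i).sat x = Literature.Computability.Complexity.Clause.eval σ (cs i))
    (hvars : ∀ i, ∀ l ∈ cs i, l.1 < n) {d : ℕ} (hlen : ∀ i, (cs i).length ≤ d)
    {E : MvPolynomial ℕ ℝ →ₗ[ℝ] ℝ} (hE : IsPseudoexpectation d E)
    (hB : ∀ v : ℕ, SatisfiesIdentity d E (boolAxiom v))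
    (hC : ∀ i, SatisfiesIdentity d E (unsatPoly (cs i)))
    {d' : ℕ} (hd' : d' ≤ d) {c : ℝ} (hc : c < 1) :
    ¬ HasSosCertificate d' (fun x => c - I.val x) := by
  classical
  rintro ⟨t, g, hg, hcert⟩
  -- representing polynomials of the `g_j`
  choose Pg hPdeg hPeval using hg
  have hMpos : (0 : ℝ) < I.M := by exact_mod_cast I.M_pos
  have hMne : (I.M : ℝ) ≠ 0 := hMpos.ne'
  -- the value polynomial and the lifted identity, in the variables `Fin n`
  set V : MvPolynomial (Fin n) ℝ :=
    C (1 / (I.M : ℝ)) * ∑ i : Fin I.M, (1 - unsatPolyFin (cs i) (hvars i)) with hV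
  set Q : MvPolynomial (Fin n) ℝ := C c - V - ∑ j, Pg j * Pg j with hQ
  -- (1) `Q` vanishes on `{0,1}ⁿ`
  have hQzero : ∀ x : Fin n → ℝ, (∀ i, x i = 0 ∨ x i = 1) → eval x Q = 0 := by
    intro x hx
    set xb : Fin n → Bool := fun i => decide (x i = 1) with hxb
    have hσ : ∀ (v : ℕ) (h : v < n), boolOf (extReal x) v = xb ⟨v, h⟩ := by
      intro v h
      simp [boolOf, extReal, h, hxb]
    have hpt : cubePoint xb = x := by
      funext i
      simp only [cubePoint, hxb, decide_eq_true_eq]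
      rcases hx i with h | h <;> simp [h]
    have hval : eval x V = I.val xb := by
      have hterm : ∀ i : Fin I.M, eval x (1 - unsatPolyFin (cs i) (hvars i)) =
          if (I.cons i).sat xb then 1 else 0 := by
        intro i
        rw [map_sub, map_one, eval_unsatPolyFin_zeroOne (cs i) (hvars i) x hx,
          hsat i xb (boolOf (extReal x)) hσ]
        split_ifs <;> norm_num
      rw [hV, map_mul, eval_C, map_sum, Finset.sum_congr rfl fun i _ => hterm i]
      unfold CSPInstance.val
      rw [one_div, inv_mul_eq_div]
    have hsq : ∀ j, eval x (Pg j * Pg j) = g j xb ^ 2 := by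
      intro j
      rw [map_mul, ← hpt, hPeval j xb, sq]
    have hc' : c - I.val xb = ∑ j, g j xb ^ 2 := hcert xb
    rw [hQ, map_sub, map_sub, eval_C, hval, map_sum]
    simp_rw [hsq]
    rw [hc', sub_self]
  -- (2) `deg Q ≤ d`
  have hdegV : V.totalDegree ≤ d := by
    rw [hV]
    refine (totalDegree_mul _ _).trans ?_
    rw [totalDegree_C, zero_add]
    refine (totalDegree_finsetSum _ _).trans (Finset.sup_le fun i _ => ?_)
    refine (totalDegree_sub _ _).trans (max_le ?_ ?_)
    · rw [totalDegree_one]; exact Nat.zero_le _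
    · exact (totalDegree_unsatPolyFin_le _ _).trans (hlen i)
  have hdegP : ∀ j, (Pg j * Pg j).totalDegree ≤ d := by
    intro j
    refine (totalDegree_mul _ _).trans ?_
    have := hPdeg j
    omega
  have hdegQ : Q.totalDegree ≤ d := by
    rw [hQ]
    refine (totalDegree_sub _ _).trans (max_le ((totalDegree_sub _ _).trans (max_le ?_ hdegV)) ?_)
    · rw [totalDegree_C]; exact Nat.zero_le _
    · exact (totalDegree_finsetSum _ _).trans (Finset.sup_le fun j _ => hdegP j)
  -- (3) apply `E` to `rename Fin.val Q`
  have hEQ := eq_zero_of_forall_eval_zeroOne hB Q hQzero hdegQ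
  have hE1 : E 1 = 1 := hE.1
  have hEC : ∀ a : ℝ, E (C a) = a := by
    intro a
    rw [show (C a : MvPolynomial ℕ ℝ) = a • (1 : MvPolynomial ℕ ℝ) by
      rw [Algebra.smul_def, mul_one]; rfl, map_smul, hE1, smul_eq_mul, mul_one]
  have hEuns : ∀ i, E (unsatPoly (cs i)) = 0 := by
    intro i
    have := hC i 1 (by rw [totalDegree_one, add_zero, totalDegree_unsatPoly]; exact hlen i)
    rwa [mul_one] at this
  have hrenV : rename Fin.val V = (1 / (I.M : ℝ)) • ∑ i : Fin I.M, ((1 : MvPolynomial ℕ ℝ) - unsatPoly (cs i)) := by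
    rw [hV, map_mul, rename_C, map_sum, Algebra.smul_def]
    congr 1
    refine Finset.sum_congr rfl fun i _ => ?_
    rw [map_sub, map_one, rename_unsatPolyFin]
  have hEV : E (rename Fin.val V) = 1 := by
    rw [hrenV, map_smul, map_sum]
    simp_rw [map_sub, hE1, hEuns, sub_zero]
    rw [Finset.sum_const, Finset.card_univ, Fintype.card_fin, nsmul_eq_mul, mul_one, smul_eq_mul]
    field_simp
  have hEsq : ∀ j, 0 ≤ E (rename Fin.val (Pg j) * rename Fin.val (Pg j)) := fun j =>
    hE.2 _ (by have := (totalDegree_rename_le Fin.val (Pg j)).trans (hPdeg j); omega)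
  have hrenQ : rename Fin.val Q =
      C c - rename Fin.val V - ∑ j, rename Fin.val (Pg j) * rename Fin.val (Pg j) := by
    rw [hQ, map_sub, map_sub, rename_C, map_sum]
    simp_rw [map_mul]
  rw [hrenQ, map_sub, map_sub, hEC, hEV, map_sum] at hEQ
  have : (0 : ℝ) ≤ ∑ j, E (rename Fin.val (Pg j) * rename Fin.val (Pg j)) :=
    Finset.sum_nonneg fun j _ => hEsq j
  linarith

/-! ### Clause tuples: `SOSFailsToRefute` refutes cube certificates of the Max-3SAT instance -/

/-- **`SOSFailsToRefute d (List.ofFn ω) ⇒` no degree-`d'` cube certificate of `c − ℑ_ω` below `1`**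
(`3 ≤ d`, `d' ≤ d`), for the Max-3SAT instance `satInstance ω` of a clause tuple
`ω : Fin m → kClauses 3 n`. In particular every MetaComplexity-side SOS lower bound for
3-CNFs (e.g. `kmow_sos_random_kSAT_holds`) yields the cube-side hypothesis of the
Lee–Raghavendra–Steurer theorems. [cite: arXiv170104521, §2.3] -/
theorem not_hasSosCertificate_of_sosFailsToRefute {n m : ℕ} (ω : Fin m → ↥(kClauses 3 n))
    (hm : 0 < m) {d : ℕ} (hd3 : 3 ≤ d)
    (h : SOSFailsToRefute d (List.ofFn fun i => ((ω i : ↥(kClauses 3 n)) : Clause ℕ)))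
    {d' : ℕ} (hd' : d' ≤ d) {c : ℝ} (hc : c < 1) :
    ¬ HasSosCertificate d' (fun x => c - (satInstance ω hm).val x) := by
  obtain ⟨E, hE, hB, hC⟩ := h
  refine not_hasSosCertificate_of_pseudoexpectation (satInstance ω hm)
    (fun i => ((ω i : ↥(kClauses 3 n)) : Clause ℕ)) (fun i x σ hσ => satConstraint_sat (ω i) x σ hσ)
    (fun i => fst_lt_of_mem_kClauses (ω i).2)
    (fun i => by rw [length_of_mem_kClauses (ω i).2]; exact hd3) hE hB (fun i => hC _ ?_) hd' hc
  rw [List.mem_ofFn]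
  exact ⟨i, rfl⟩

end Literature.Combinatorics.Optimization
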